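import Mathlib
import HarnessLib
import Literature.Analysis.FluidPDE.SereginSverakPressureLocalTypeI
import Summits.NavierStokesRegularity.NavierStokesRegularity.Theorems.TypeIQuarterGateScarZoomDefs
import Summits.NavierStokesRegularity.NavierStokesRegularity.Theorems.TypeIQuarterGateScarEnvelopeTypeITwinZoomLimit
import Summits.NavierStokesRegularity.NavierStokesRegularity.Theorems.TypeICertificateLadderNoTypeIBlowupTypeIMorrey

/-!
# Line `scar_zoom` on crux `TypeIQuarterGate.ScarEnvelopeTypeI` (stmt-NavierStokesRegularity-23843) —
# STUB B `stub_scarZoom`: envelope violators at a scar zoom to a TWIN-SCAR OBJECT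

The registered stub `stub_scarZoom` (skeleton `Cruxes/ScarEnvelopeTypeI/Lines/scar_zoom.lean`, line
owner ns-idea-7 g0, critic idea-crit-7 PASS-WITH-PRICE, price P3) proved VERBATIM and
UNCONDITIONALLY:

  `CruxHypotheses ν T u p → ScarViolators T u → ∃ M v, TwinScarObject M v`.

Proof (every input a kernel-checked tree theorem).
1. `morrey_of_typeI` (Morrey-type bound of a Type-I solution, Seregin–Šverák 2009 Lemma 3.5) and
   `exists_zoom_typeIBound_lt_top_of_morrey` (Albritton–Barker 2019 Lemma 2.6: the viscosity-
   normalising zoom `v = α u(T + β·, a + R·)` about the scar `(T, a)` is a suitable weak solution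
   in `Q(0, 1)` of Albritton–Barker's class with a weak gradient and `𝐈(Q(0, 1/2)) < ∞`); the
   rate of `v` on a final window from `exists_typeI_rate_window`.
2. The violators `(t_k, x_k) → (T, a)` with `‖x_k − a‖ ‖u(t_k, x_k)‖ → ∞` make `(T, a)` a genuine
   singular point (`¬ IsBackwardBoundedAt u T a`), so the origin is a backward singular point of `v`
   (`SereginSverak2002.isBackwardBoundedAt_of_zoom`).
3. The twin zoom (file 3, `exists_typeIAncientMild_twinZoomLimit` = the tree's Barker–Prange /
   Albritton–Barker zoom at a prescribed singular vertex with PRESCRIBED scales, plus a satellite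
   blow-up sequence): scales `ρ_k/R`, `ρ_k = ‖x_k − a‖`; satellites `e_k = (x_k − a)/ρ_k ∈ S²`
   (a convergent subsequence `e_k → e`), zoomed times `s_k = (t_k − T) R²/(β ρ_k²) → 0⁻`
   (the parabolic-ratio clause of `ScarViolators`), values `(α/R) ρ_k ‖u(t_k, x_k)‖ → ∞`.  Output:
   `U ∈ IsTypeIAncientMild C₁` (KNSS Oseen-mild class, rate `C₁`), suitable on the backward slab
   with `𝐈 < ∞`, backward-singular at the origin AND at `(0, e)` (persistence of singularities,
   A–B Prop. 2.3, at both points).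
4. `TwinScarObject C₁ U`: the uniform local energy bound from `𝐈 < ∞` (`A(Q((0,x₀),1)) ≤ 𝐈`,
   essential sup in time upgraded to every time by joint continuity: Fatou), and `SingularAt` from
   the essential unboundedness on every backward parabolic cylinder.

No statement about the crux `ScarEnvelopeTypeI`, its parent `QuarterLawTypeI` or the summit is
proved by this file: the deciding stub `stub_noCascadeSplitting` (no twin-scar object) stays open.
-/

noncomputable section

-- the summit-side namespace `Summit.NavierStokesRegularity.NavierStokesRegularity.…` (single-conjunct
-- summit, D-0017) repeats a component by design; the dupNamespace linter would flag every declaration.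
set_option linter.dupNamespace false

namespace Summit.NavierStokesRegularity.NavierStokesRegularity.Cruxes.ScarEnvelopeTypeI.ScarZoom

open MeasureTheory Set Function Filter Topology TopologicalSpace Metric
open scoped NNReal ENNReal
open Literature.Analysis Literature.Analysis.FluidPDE

local notation "E3" => EuclideanSpace ℝ (Fin 3)

/-! ### Tool 1: slice energies of a continuous field are bounded by the essential supremum -/

/-- `sup_t ≤ esssup_t` for the scaled energy of a field continuous on the open time slab of the
ball: `t ↦ ∫_{B_r} |u(t)|²` is lower semicontinuous (Fatou), so each value is attained on a set of
times of positive measure.  (Copy of the tree's Theorems-side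
`cknA_le_cknAEss_of_continuousOn`, kept private to avoid a heavy import.) -/
private theorem cknA_le_cknAEss_of_continuousOn' {u : ℝ → E3 → E3} {r : ℝ} {z : ℝ × E3}
    (hcont : ContinuousOn (uncurry u) (Ioo (z.1 - r ^ 2) z.1 ×ˢ univ)) :
    cknA r z u ≤ cknAEss r z u := by
  unfold cknA cknAEss
  set I : Set ℝ := Ioo (z.1 - r ^ 2) z.1 with hI
  set Gf : ℝ → ℝ≥0∞ := fun s => ∫⁻ x in ball z.2 r, ‖u s x‖ₑ ^ 2 with hGf
  have hconst : (fun s => (ENNReal.ofReal r)⁻¹ * ∫⁻ x in ball z.2 r, ‖u s x‖ₑ ^ 2) =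
      fun s => (ENNReal.ofReal r)⁻¹ * Gf s := rfl
  rw [hconst, ENNReal.essSup_const_mul]
  refine iSup₂_le fun t ht => ?_
  set μ : Measure ℝ := volume.restrict I with hμ
  suffices key : Gf t ≤ essSup Gf μ from mul_le_mul' le_rfl key
  by_contra hlt
  push Not at hlt
  have htI : t ∈ I := ht
  have hmeas : ∀ i : I,
      AEMeasurable (fun x => ‖u i.1 x‖ₑ ^ 2) (volume.restrict (ball z.2 r)) := by
    intro i
    have hc : Continuous (u i.1) := by
      have h1 : Continuous fun x : E3 => uncurry u (i.1, x) :=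
        hcont.comp_continuous (continuous_const.prodMk continuous_id)
          fun x => ⟨i.2, mem_univ _⟩
      exact h1
    exact (hc.measurable.enorm.pow_const 2).aemeasurable
  have hFatou := lintegral_liminf_le' (μ := volume.restrict (ball z.2 r))
    (u := 𝓝 (⟨t, htI⟩ : I)) hmeas
  have hpt : ∀ x,
      liminf (fun i : I => ‖u i.1 x‖ₑ ^ 2) (𝓝 ⟨t, htI⟩) = ‖u t x‖ₑ ^ 2 := by
    intro x
    refine Tendsto.liminf_eq ?_
    have hca : ContinuousAt (uncurry u) (t, x) :=
      hcont.continuousAt ((isOpen_Ioo.prod isOpen_univ).mem_nhds ⟨ht, mem_univ _⟩)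
    have h1 : Tendsto (fun s : ℝ => uncurry u (s, x)) (𝓝 t) (𝓝 (uncurry u (t, x))) :=
      hca.tendsto.comp ((continuous_id.prodMk continuous_const).tendsto t)
    have h2 : Tendsto (fun i : I => u i.1 x) (𝓝 ⟨t, htI⟩) (𝓝 (u t x)) :=
      h1.comp (continuous_subtype_val.tendsto _)
    exact ENNReal.Tendsto.pow h2.enorm
  rw [lintegral_congr fun x => hpt x] at hFatou
  have hev : ∀ᶠ i : I in 𝓝 ⟨t, htI⟩, essSup Gf μ < Gf i.1 :=
    eventually_lt_of_lt_liminf (hlt.trans_le hFatou)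
  rw [eventually_nhds_subtype_iff I ⟨t, htI⟩ (fun s => essSup Gf μ < Gf s),
    isOpen_Ioo.nhdsWithin_eq htI, Metric.eventually_nhds_iff] at hev
  obtain ⟨ε, hε, hball⟩ := hev
  have hpos : 0 < volume (ball t ε ∩ I) :=
    (isOpen_ball.inter isOpen_Ioo).measure_pos volume ⟨t, mem_ball_self hε, htI⟩
  have hnull : μ {s | essSup Gf μ < Gf s} = 0 := meas_essSup_lt
  have hsub : ball t ε ∩ I ⊆ {s | essSup Gf μ < Gf s} ∩ I :=
    fun s hs => ⟨hball hs.1, hs.2⟩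
  rw [hμ, Measure.restrict_apply' measurableSet_Ioo] at hnull
  exact hpos.ne' (measure_mono_null hsub hnull)

/-- **Uniform local energy up to the final time from `𝐈 < ∞`**: for a field continuous on the
open backward slab with finite Albritton–Barker quantity on the slab,
`∫_{B(x₀,1)} |U(t)|² ≤ 𝐈` for EVERY `x₀` and EVERY `t ∈ (−1, 0)` (`A(Q((0,x₀),1)) ≤ 𝐈`, and the
essential supremum in time bounds every slice by Tool 1). -/
theorem exists_localEnergy_of_typeIBound {U : ℝ → E3 → E3} {P : ℝ → E3 → ℝ}
    {H : ℝ → E3 → E3 →L[ℝ] E3}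
    (hUc : ContinuousOn (uncurry U) (Iio 0 ×ˢ univ))
    (hI : typeIBound (Iio (0 : ℝ) ×ˢ univ) U P H < ⊤) :
    ∃ E : ℝ, ∀ x₀ : E3, ∀ t ∈ Ioo (-1 : ℝ) 0,
      ∫⁻ y in ball x₀ 1, ENNReal.ofReal (‖U t y‖ ^ 2) ≤ ENNReal.ofReal E := by
  refine ⟨(typeIBound (Iio (0 : ℝ) ×ˢ univ) U P H).toReal, fun x₀ t ht => ?_⟩
  rw [ENNReal.ofReal_toReal hI.ne]
  have hsub : parabolicCylinder 1 (((0 : ℝ), x₀) : ℝ × E3) ⊆ Iio (0 : ℝ) ×ˢ (univ : Set E3) := by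
    intro w hw
    rw [mem_parabolicCylinder] at hw
    exact ⟨hw.1.2, mem_univ _⟩
  have hA : cknAEss 1 (((0 : ℝ), x₀) : ℝ × E3) U ≤ typeIBound (Iio (0 : ℝ) ×ˢ univ) U P H :=
    (cknAEss_le_abScaledSum (p := P) (G := H)).trans (abScaledSum_le_typeIBound one_pos hsub)
  have hcontz : ContinuousOn (uncurry U)
      (Ioo ((((0 : ℝ), x₀) : ℝ × E3).1 - 1 ^ 2) (((0 : ℝ), x₀) : ℝ × E3).1 ×ˢ univ) :=
    hUc.mono (prod_mono (fun s hs => hs.2) Subset.rfl)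
  have hA' := (cknA_le_cknAEss_of_continuousOn' hcontz).trans hA
  have ht' : t ∈ Ioo ((((0 : ℝ), x₀) : ℝ × E3).1 - 1 ^ 2) (((0 : ℝ), x₀) : ℝ × E3).1 := by
    constructor
    · show (0 : ℝ) - 1 ^ 2 < t
      linarith [ht.1]
    · exact ht.2
  have hle : (ENNReal.ofReal (1 : ℝ))⁻¹ * ∫⁻ y in ball x₀ 1, ‖U t y‖ₑ ^ 2 ≤
      cknA 1 (((0 : ℝ), x₀) : ℝ × E3) U :=
    le_iSup₂ (f := fun s (_ : s ∈ Ioo ((((0 : ℝ), x₀) : ℝ × E3).1 - 1 ^ 2) (((0 : ℝ), x₀) : ℝ × E3).1) =>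
      (ENNReal.ofReal (1 : ℝ))⁻¹ * ∫⁻ y in ball x₀ 1, ‖U s y‖ₑ ^ 2) t ht'
  rw [ENNReal.ofReal_one, inv_one, one_mul] at hle
  have e : ∫⁻ y in ball x₀ 1, ENNReal.ofReal (‖U t y‖ ^ 2) = ∫⁻ y in ball x₀ 1, ‖U t y‖ₑ ^ 2 := by
    refine lintegral_congr fun y => ?_
    rw [ENNReal.ofReal_pow (norm_nonneg _), ofReal_norm]
  rw [e]
  exact hle.trans hA'

/-! ### Tool 2: essential unboundedness gives pointwise unboundedness -/

/-- A backward singular point `(0, a)` in the essential sense (`IsBackwardSingularPoint`: the field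
is essentially unbounded on every `Q((0,a), r)`) is a singular point in the pointwise sense of the
line (`SingularAt`: unbounded on every `B_r(a) × (−r², 0)`). -/
theorem singularAt_of_isBackwardSingularPoint {v : ℝ → E3 → E3} {a : E3}
    (h : IsBackwardSingularPoint v (((0 : ℝ), a) : ℝ × E3)) : SingularAt v a := by
  intro r hr A
  by_contra hcon
  push Not at hcon
  have hfin : eLpNorm (uncurry v) ⊤
      (volume.restrict (parabolicCylinder r (((0 : ℝ), a) : ℝ × E3))) < ⊤ := by
    rw [eLpNorm_exponent_top]
    refine eLpNormEssSup_lt_top_of_ae_bound (C := A) ?_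
    refine (ae_restrict_mem (isOpen_parabolicCylinder r _).measurableSet).mono ?_
    rintro ⟨s, y⟩ hz
    rw [mem_parabolicCylinder] at hz
    have hs : s ∈ Ioo (-(r ^ 2)) 0 := ⟨by linarith [hz.1.1], hz.1.2⟩
    exact hcon s hs y hz.2
  exact hfin.ne (h r hr)

/-! ### STUB B -/

/-- **STUB B of line `scar_zoom` (registered signature, verbatim).**  Under the crux hypotheses,
envelope violators at a scar produce a TWIN-SCAR OBJECT: a Type-I ancient mild solution in the
KNSS/Oseen gauge with uniformly bounded local energy up to the final time, singular at time `0`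
both at the origin and at a point of the unit sphere.  Proof: Morrey bound + viscosity-normalising
zoom about the scar (A–B Lemma 2.6), the scar is a genuine singular point (violators), twin zoom at
the prescribed scales `‖x_k − a‖/R` with the satellites `(x_k − a)/‖x_k − a‖` (file 3: KNSS/A–B
compactness, `𝐈`-control of the scaled energies, persistence of singularities at BOTH points), and
the repackaging of Tools 1–2.  See the module docstring. -/
theorem stub_scarZoom :
    ∀ (ν T : ℝ) (u : ℝ → E3 → E3) (p : ℝ → E3 → ℝ),
      CruxHypotheses ν T u p → ScarViolators T u →
        ∃ (M : ℝ) (v : ℝ → E3 → E3), TwinScarObject M v := by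
  intro ν T u p hH hV
  obtain ⟨hν, hT, hmax, hLH, -, hTI, -⟩ := hH
  obtain ⟨a, x, t, ht, hxa, ht_tend, hx_tend, hratio, hprod⟩ := hV
  have hsol := hmax.1
  -- ## (1) Morrey bound and the viscosity-normalising zoom about the scar `(T, a)`
  obtain ⟨r₀, M₀, T₁, hr₀, hT₁, hMor⟩ :=
    Summit.NavierStokesRegularity.NavierStokesRegularity.Theorems.morrey_of_typeI hν hT hsol hLH hTI
  obtain ⟨R, α, β, hR, hα, hβ, -, -, hβT, hball, hGv, htypeI⟩ :=
    Summit.NavierStokesRegularity.NavierStokesRegularity.Theorems.exists_zoom_typeIBound_lt_top_of_morrey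
      hν hT hsol hLH hr₀ hT₁ hMor a
  set q : ℝ → E3 → ℝ := fun t x => p t x - (p t 0 - normalisedPressure (u t) 0) with hq
  set v : ℝ → E3 → E3 := α • stPull β R T a u with hv
  set πv : ℝ → E3 → ℝ := α ^ 2 • stPull β R T a q with hπv
  set Gv : ℝ → E3 → E3 →L[ℝ] E3 := (α * R) • stPull β R T a (fun t x => fderiv ℝ (u t) x)
    with hGvdef
  -- ## (2) the scar is a genuine singular point: the origin is backward singular for `v`
  have hnorm : Tendsto (fun k => ‖u (t k) (x k)‖) atTop atTop := by
    have hdist : Tendsto (fun k => ‖x k - a‖) atTop (𝓝 0) :=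
      tendsto_iff_norm_sub_tendsto_zero.1 hx_tend
    have hsmall : ∀ᶠ k in atTop, ‖x k - a‖ ≤ 1 :=
      hdist.eventually (Iic_mem_nhds one_pos)
    refine tendsto_atTop_mono' atTop ?_ hprod
    filter_upwards [hsmall] with k hk
    calc ‖x k - a‖ * ‖u (t k) (x k)‖ ≤ 1 * ‖u (t k) (x k)‖ :=
        mul_le_mul_of_nonneg_right hk (norm_nonneg _)
      _ = ‖u (t k) (x k)‖ := one_mul _
  have hnotbd : ¬ IsBackwardBoundedAt u T a := by
    rintro ⟨r, hr, K, hK⟩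
    have h1 : ∀ᶠ k in atTop, T - r ^ 2 < t k := ht_tend.eventually (lt_mem_nhds (by nlinarith))
    have h2 : ∀ᶠ k in atTop, x k ∈ ball a r := hx_tend.eventually_mem (ball_mem_nhds a hr)
    have h3 : ∀ᶠ k in atTop, K < ‖u (t k) (x k)‖ := hnorm.eventually (eventually_gt_atTop K)
    obtain ⟨k, hk1, hk2, hk3⟩ := (h1.and (h2.and h3)).exists
    exact absurd (hK (t k) ⟨hk1, (ht k).2⟩ (x k) hk2) (not_le.2 hk3)
  have hsing : IsBackwardSingularPoint v (0 : ℝ × E3) := by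
    intro r hr
    by_contra hfin
    have hfin' : eLpNorm (uncurry v) ⊤
        (volume.restrict (parabolicCylinder (min r 1) (0 : ℝ × E3))) < ⊤ := by
      refine lt_of_le_of_lt (eLpNorm_mono_measure _ (Measure.restrict_mono ?_ le_rfl))
        (lt_top_iff_ne_top.2 hfin)
      exact parabolicCylinder_mono (le_min hr.le zero_le_one) (min_le_left _ _) _
    exact hnotbd (SereginSverak2002.isBackwardBoundedAt_of_zoom hsol a hR hα hβ hβT
      (lt_min hr one_pos) (min_le_right _ _) hfin')
  -- ## (3) the rate of the zoom on a final window
  obtain ⟨C, δ, hC0, hδ, -, hrate⟩ :=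
    Summit.NavierStokesRegularity.NavierStokesRegularity.Theorems.exists_typeI_rate_window hT hTI
  set C₁ : ℝ := α * C / Real.sqrt β with hC₁def
  have hratev : ∀ s ∈ Ioo (-(δ / β)) 0, ∀ y, ‖v s y‖ ≤ C₁ / Real.sqrt (-s) := by
    intro s hs y
    have h1 : -δ < β * s := by
      have h := mul_lt_mul_of_pos_left hs.1 hβ
      rwa [mul_neg, mul_div_cancel₀ _ hβ.ne'] at h
    have h2 : β * s < 0 := mul_neg_of_pos_of_neg hβ hs.2
    have hb := hrate (T + β * s) ⟨by linarith, by linarith⟩ (a + R • y)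
    have hsq : Real.sqrt (T - (T + β * s)) = Real.sqrt β * Real.sqrt (-s) := by
      rw [show T - (T + β * s) = β * (-s) by ring, Real.sqrt_mul hβ.le]
    rw [hsq] at hb
    have hpos : 0 < Real.sqrt (-s) := Real.sqrt_pos.2 (by linarith [hs.2])
    have hposβ : 0 < Real.sqrt β := Real.sqrt_pos.2 hβ
    rw [hv, smul_stPull_apply, norm_smul, Real.norm_of_nonneg hα.le, hC₁def]
    rw [div_div, le_div_iff₀ (by positivity)]
    calc α * ‖u (T + β * s) (a + R • y)‖ * (Real.sqrt β * Real.sqrt (-s))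
        = α * (Real.sqrt β * Real.sqrt (-s) * ‖u (T + β * s) (a + R • y)‖) := by ring
      _ ≤ α * C := mul_le_mul_of_nonneg_left hb hα.le
  -- ## (4) the data of the twin zoom on the cylinder `Q(0, ρ')`
  set ρ' : ℝ := min (1 / 2) (Real.sqrt (δ / β)) with hρ'def
  have hρ' : 0 < ρ' := lt_min (by norm_num) (Real.sqrt_pos.2 (div_pos hδ hβ))
  have hρ'half : ρ' ≤ 1 / 2 := min_le_left _ _
  have hρ'1 : ρ' ≤ 1 := hρ'half.trans (by norm_num)
  have hρ'sq : ρ' ^ 2 ≤ δ / β := by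
    have h1 : ρ' ≤ Real.sqrt (δ / β) := min_le_right _ _
    have := pow_le_pow_left₀ hρ'.le h1 2
    rwa [Real.sq_sqrt (div_pos hδ hβ).le] at this
  have hsub1 : parabolicCylinder ρ' (0 : ℝ × E3) ⊆ parabolicCylinder 1 (0 : ℝ × E3) :=
    parabolicCylinder_mono hρ'.le hρ'1 _
  have hsubh : parabolicCylinder ρ' (0 : ℝ × E3) ⊆ parabolicCylinder (1 / 2) (0 : ℝ × E3) :=
    parabolicCylinder_mono hρ'.le hρ'half _
  have hball' : IsSuitableWeakSolutionInBall ρ' 0 v πv := hball.of_subset_zero hρ' hsub1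
  have hGv' : HasWeakSpatialGradientOn (parabolicCylinderOpens ρ' (0 : ℝ × E3)) v Gv :=
    hGv.mono fun w hw => hsub1 hw
  have hI' : typeIBound (parabolicCylinder ρ' (0 : ℝ × E3)) v πv Gv < ⊤ :=
    lt_of_le_of_lt (typeIBound_mono hsubh) htypeI
  -- time window of `Q(0, ρ')`: `-(δ/β) ≤ -ρ'² < s < 0` and `0 ≤ T + β s < T`
  have hwin : ∀ w ∈ parabolicCylinder ρ' (0 : ℝ × E3), w.1 ∈ Ioo (-(δ / β)) 0 ∧
      T + β * w.1 ∈ Ico 0 T := by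
    intro w hw
    rw [mem_parabolicCylinder] at hw
    simp only [Prod.fst_zero, zero_sub] at hw
    obtain ⟨⟨h1, h2⟩, -⟩ := hw
    have h3 : -(δ / β) < w.1 := by linarith
    have hρ'sq1 : ρ' ^ 2 ≤ 1 := by nlinarith
    have h4 : β * ρ' ^ 2 ≤ β * 1 := mul_le_mul_of_nonneg_left hρ'sq1 hβ.le
    have h5 : β * (-ρ' ^ 2) < β * w.1 := mul_lt_mul_of_pos_left h1 hβ
    have h6 : β * w.1 < β * 0 := mul_lt_mul_of_pos_left h2 hβ
    refine ⟨⟨h3, h2⟩, ?_, by linarith⟩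
    linarith
  have hvc' : ContinuousOn (uncurry v) (parabolicCylinder ρ' (0 : ℝ × E3)) := by
    have hcontu : ContinuousOn (uncurry u) (Ico 0 T ×ˢ univ) := hsol.smooth_velocity.continuousOn
    have e : uncurry v = fun w => α • (uncurry u ∘ stAffine β R T a) w := by
      funext w
      rfl
    rw [e]
    refine ContinuousOn.const_smul (hcontu.comp (continuous_stAffine _ _ _ _).continuousOn ?_) α
    intro w hw
    rw [mem_prod, stAffine_fst]
    exact ⟨(hwin w hw).2, mem_univ _⟩
  have hrate' : ∀ (s : ℝ) (y : E3), (s, y) ∈ parabolicCylinder ρ' (0 : ℝ × E3) →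
      ‖v s y‖ ≤ C₁ / Real.sqrt ((0 : ℝ × E3).1 - s) := by
    intro s y hsy
    show ‖v s y‖ ≤ C₁ / Real.sqrt ((0 : ℝ) - s)
    rw [zero_sub]
    exact hratev s (hwin _ hsy).1 y
  -- ## (5) scales, satellites and the values at the satellites
  have hρpos : ∀ k, 0 < ‖x k - a‖ := fun k => norm_pos_iff.2 (sub_ne_zero.2 (hxa k))
  set Rz : ℕ → ℝ := fun k => ‖x k - a‖ / R with hRz
  have hRz_pos : ∀ k, 0 < Rz k := fun k => div_pos (hρpos k) hR
  have hRz0 : Tendsto Rz atTop (𝓝 0) := by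
    have h := (tendsto_iff_norm_sub_tendsto_zero.1 hx_tend).div_const R
    rwa [zero_div] at h
  set sN : ℕ → ℝ := fun k => (t k - T) / (β * Rz k ^ 2) with hsN
  have hsN_neg : ∀ k, sN k < 0 := fun k =>
    div_neg_of_neg_of_pos (by linarith [(ht k).2]) (mul_pos hβ (pow_pos (hRz_pos k) 2))
  have hsN0 : Tendsto sN atTop (𝓝 0) := by
    have e : ∀ k, sN k = -(R ^ 2 / β) * ((T - t k) / ‖x k - a‖ ^ 2) := by
      intro k
      have h1 : ‖x k - a‖ ≠ 0 := (hρpos k).ne'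
      simp only [hsN, hRz]
      field_simp
      ring
    rw [show sN = fun k => -(R ^ 2 / β) * ((T - t k) / ‖x k - a‖ ^ 2) from funext e]
    simpa using hratio.const_mul (-(R ^ 2 / β))
  set ηN : ℕ → E3 := fun k => ‖x k - a‖⁻¹ • (x k - a) with hηN
  have hηN_mem : ∀ k, ηN k ∈ sphere (0 : E3) 1 := by
    intro k
    rw [mem_sphere_zero_iff_norm, hηN]
    dsimp only
    rw [norm_smul, norm_inv, norm_norm, inv_mul_cancel₀ (hρpos k).ne']
  obtain ⟨e, he, ψ, hψ, hηe⟩ := (isCompact_sphere (0 : E3) 1).tendsto_subseq hηN_mem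
  have he1 : ‖e‖ = 1 := mem_sphere_zero_iff_norm.1 he
  -- the zoom of `v` at scale `Rz k` evaluated at the satellite is `α u(t_k, x_k)`
  have harg1 : ∀ k, T + β * (Rz k ^ 2 * sN k) = t k := by
    intro k
    have h1 : Rz k ≠ 0 := (hRz_pos k).ne'
    simp only [hsN]
    field_simp
    ring
  have harg2 : ∀ k, a + R • (Rz k • ηN k) = x k := by
    intro k
    have h1 : ‖x k - a‖ ≠ 0 := (hρpos k).ne'
    simp only [hRz, hηN, smul_smul]
    rw [show R * (‖x k - a‖ / R * ‖x k - a‖⁻¹) = 1 by field_simp, one_smul, add_sub_cancel]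
  have hval : ∀ k, Rz k * ‖v ((0 : ℝ × E3).1 + Rz k ^ 2 * sN k) ((0 : ℝ × E3).2 + Rz k • ηN k)‖ =
      (α / R) * (‖x k - a‖ * ‖u (t k) (x k)‖) := by
    intro k
    rw [Prod.fst_zero, Prod.snd_zero, zero_add, zero_add, hv, smul_stPull_apply, harg1, harg2,
      norm_smul, Real.norm_of_nonneg hα.le, hRz]
    ring
  have hsat : Tendsto (fun n => Rz (ψ n) *
      ‖v ((0 : ℝ × E3).1 + Rz (ψ n) ^ 2 * sN (ψ n)) ((0 : ℝ × E3).2 + Rz (ψ n) • ηN (ψ n))‖)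
      atTop atTop := by
    simp only [hval]
    exact (hprod.comp hψ.tendsto_atTop).const_mul_atTop (div_pos hα hR)
  -- ## (6) the twin zoom limit
  obtain ⟨U, P, H, hTI', -, -, hIU, hsing0, hsinge⟩ :=
    exists_typeIAncientMild_twinZoomLimit (z₀ := (0 : ℝ × E3)) (M := C₁) hρ' hball' hGv' hI' hvc'
      hrate' hsing (R := fun n => Rz (ψ n)) (fun n => hRz_pos (ψ n)) (hRz0.comp hψ.tendsto_atTop)
      (s := fun n => sN (ψ n)) (η := fun n => ηN (ψ n)) (e := e) (fun n => hsN_neg (ψ n))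
      (hsN0.comp hψ.tendsto_atTop) hηe hsat
  -- ## (7) the twin-scar object
  obtain ⟨E, hE⟩ := exists_localEnergy_of_typeIBound hTI'.continuousOn_uncurry hIU
  refine ⟨C₁, U, hTI', ⟨E, hE⟩, ?_, e, he1, singularAt_of_isBackwardSingularPoint hsinge⟩
  exact singularAt_of_isBackwardSingularPoint
    (show IsBackwardSingularPoint U (((0 : ℝ), (0 : E3)) : ℝ × E3) from hsing0)

end Summit.NavierStokesRegularity.NavierStokesRegularity.Cruxes.ScarEnvelopeTypeI.ScarZoom

end
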